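import Literature.NumberTheory.Automorphic.UnipotentDiagConjModulus
import Literature.NumberTheory.Automorphic.SiegelSetVolume
import HarnessLib

/-!
# The modulus of diagonal conjugation on `N_n(𝔸_K)`: explicit formula
# `χ(diag(z(a))) = ∏_{i<j} (aᵢ/aⱼ)^{[K:ℚ]}`

Topic `NumberTheory/Automorphic`; namespace `Literature.NumberTheory.Automorphic`. Proof file
(theorems only). The tree carries the modulus of the conjugation `u ↦ t u t⁻¹`, `t = diag(d)`, on the
upper unitriangular group `N_n(𝔸_K)` twice: qualitatively as `unipotentConjChar d`
(`UnipotentConjHaarChar`, on the subgroup `adelicUnipotent n K`, with the strict contraction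
`unipotentConjChar_posRealIdele_lt_one` that drives the dyadic finiteness of Siegel-set volumes,
`measure_mul_siegelSet_lt_top`), and quantitatively as `colRangeDiagModulus 1 (n-1) d`
(`UnipotentDiagConjModulus`, on the column-range group `adelicColRange n K 1 (n-1)`, with the explicit
product `colRangeDiagModulus_one_eq_prod = ∏_{c} ∏_{i<c} ‖dᵢ/d_c‖`). The two subgroups coincide
(`adelicColRange_one_eq_adelicUnipotent`) and the two moduli agree
(`unipotentConjChar_eq_colRangeDiagModulus`, transport of Mathlib's `mulEquivHaarChar` along an
intertwining isomorphism, `mulEquivHaarChar_eq_of_semiconj`); hence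

* `unipotentConjChar_eq_prod` — **`χ(diag(d)) = ∏_{i<j} ‖dᵢ/dⱼ‖_𝔸`** (Godement, Sém. Bourbaki 257,
  §8: the modulus of `Ad(t)` on `Lie(U_𝔸)` is the product of the positive roots; Getz–Hahn (2024),
  (3.10));
* `unipotentConjChar_posRealIdele_eq` — for a positive real diagonal `t = diag(z(a₁), …, z(aₙ))`
  (`posRealIdele`, the same real scalar at every archimedean place):
  **`χ(t) = (∏_{i<j} aᵢ/aⱼ)^{[K:ℚ]}`** (`AdeleRing.distribHaarChar_posRealIdele`: `‖z(r)‖_𝔸 = r^{[K:ℚ]}`).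

This is the quantitative input that turns «count ≤ C · (∏_{i<j} aᵢ/aⱼ)^{(1-1/N)[K:ℚ]}»
(`SiegelConeCountExponent`, `HermitianRationalPointCount`) into a bound by a power `< 1` of the factor
by which the Siegel-set pieces shrink (`exists_measure_conj_mul_mul_le`).

## References

* R. Godement, *Domaines fondamentaux des groupes arithmétiques*, Sém. Bourbaki 257 (1962/63), §8
  [Godement1964].
* J. R. Getz, H. Hahn, *An Introduction to Automorphic Representations* (2024), §3.5 (3.10)
  [GetzHahn2024].
-/

noncomputable section

open MeasureTheory Measure NumberField IsDedekindDomain Matrix Set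
open scoped MatrixGroups ENNReal NNReal

namespace Literature.NumberTheory.Automorphic

/-! ### Transport of the Haar character along an intertwining isomorphism -/

section Transport

variable {G H : Type*} [Group G] [TopologicalSpace G] [MeasurableSpace G] [BorelSpace G]
  [IsTopologicalGroup G] [LocallyCompactSpace G]
  [Group H] [TopologicalSpace H] [MeasurableSpace H] [BorelSpace H]
  [IsTopologicalGroup H] [LocallyCompactSpace H] [SecondCountableTopology H]

/-- **The Haar character is invariant under transport of structure**: if `e : G ≃ₜ* H` intertwines
`φ : G ≃ₜ* G` with `ψ : H ≃ₜ* H` (`e ∘ φ = ψ ∘ e`), then `mulEquivHaarChar φ = mulEquivHaarChar ψ`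
(push a Haar measure of `G` forward along `e`). Abstract harmonic analysis (Weil, *L'intégration dans
les groupes topologiques* (1940), §8: the module of an automorphism; Bourbaki INT VII §1 no. 4); stated
for Mathlib's `mulEquivHaarChar`. [cite: Godement1964, §8 (remark after Thm. 7)] -/
theorem mulEquivHaarChar_eq_of_semiconj (e : G ≃ₜ* H) (φ : G ≃ₜ* G) (ψ : H ≃ₜ* H)
    (h : ∀ x, e (φ x) = ψ (e x)) : mulEquivHaarChar φ = mulEquivHaarChar ψ := by
  -- a Haar measure on `G` and its image on `H`
  set ν : Measure G := haar with hν
  set μ : Measure H := ν.map e with hμ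
  haveI : IsHaarMeasure μ := e.isHaarMeasure_map ν
  haveI : μ.Regular := inferInstance
  haveI : ν.Regular := inferInstance
  have he : Measurable (e : G → H) := e.continuous.measurable
  have hφ : Measurable (φ : G → G) := φ.continuous.measurable
  have hψ : Measurable (ψ : H → H) := ψ.continuous.measurable
  -- `μ.map ψ = (ν.map φ).map e`
  have hcomp : (ψ : H → H) ∘ (e : G → H) = (e : G → H) ∘ (φ : G → G) := by
    funext x; exact (h x).symm
  have hmap : μ.map ψ = (ν.map φ).map e := by
    rw [hμ, Measure.map_map hψ he, hcomp, ← Measure.map_map he hφ]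
  -- both characters rescale `μ.map ψ` to `μ`
  have h1 : mulEquivHaarChar ψ • μ.map ψ = μ := mulEquivHaarChar_smul_map μ ψ
  have h2 : mulEquivHaarChar φ • μ.map ψ = μ := by
    rw [hmap, ← Measure.map_smul, mulEquivHaarChar_smul_map ν φ]
  -- compare on a compact set of positive finite measure
  obtain ⟨C, hCc, hC1⟩ := exists_compact_mem_nhds (1 : H)
  have hCpos : 0 < μ C :=
    (isOpen_interior.measure_pos μ ⟨1, mem_interior_iff_mem_nhds.2 hC1⟩).trans_le
      (measure_mono interior_subset)
  have hCfin : μ C < ⊤ := hCc.measure_lt_top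
  have e1 := congrArg (fun m : Measure H => m C) h1
  have e2 := congrArg (fun m : Measure H => m C) h2
  simp only [Measure.smul_apply, nnreal_smul_coe_apply] at e1 e2
  have hC' : (μ.map ψ) C ≠ 0 ∧ (μ.map ψ) C ≠ ⊤ := by
    constructor
    · intro h0; rw [h0, mul_zero] at e1; exact hCpos.ne' e1.symm
    · intro ht
      rw [ht, ENNReal.mul_top (by exact_mod_cast (mulEquivHaarChar_pos ψ).ne')] at e1
      exact hCfin.ne e1.symm
  have : (mulEquivHaarChar φ : ℝ≥0∞) = mulEquivHaarChar ψ :=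
    (ENNReal.mul_left_inj hC'.1 hC'.2).1 (e2.trans e1.symm)
  exact_mod_cast this

end Transport

/-! ### The two avatars of `N_n(𝔸_K)` and of the modulus agree -/

section Bridge

variable (n : ℕ) (K : Type) [Field K] [NumberField K]

/-- `U_{[1,n-1]}(𝔸_K) = N_n(𝔸_K)`: for an upper unitriangular matrix the only column outside
`[1, n-1]` is the column `0`, whose off-diagonal entries vanish anyway (Cogdell (2004), §1.1: the
unipotent radical of the parabolic of type `(1, 1, …, 1)` is `N_n`). [cite: Godement1964, §8 (remark after Thm. 7)] -/
theorem adelicColRange_one_eq_adelicUnipotent : adelicColRange n K 1 (n - 1) = adelicUnipotent n K := by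
  refine le_antisymm (adelicColRange_le_adelicUnipotent n K 1 (n - 1)) fun u hu => ?_
  refine ⟨hu, fun i j hij hj => ?_⟩
  have hj0 : (j : ℕ) = 0 := by
    unfold InColRange at hj
    by_contra h
    have h1 : 1 ≤ (j : ℕ) := Nat.one_le_iff_ne_zero.2 h
    have := j.2
    exact hj ⟨h1, by omega⟩
  have hlt : j < i := by
    rw [Fin.lt_def, hj0]
    exact Nat.pos_of_ne_zero fun h => hij (Fin.ext (by rw [h, hj0]))
  exact ((mem_upperUnitriangular_iff u).1 hu).1 hlt

/-- **The qualitative and the quantitative modulus agree**: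
`unipotentConjChar d = colRangeDiagModulus 1 (n-1) d` (one modulus of `Ad(t)` on `Lie(U_𝔸)`,
Godement, Sém. Bourbaki 257, §8). [cite: Godement1964, §8 (remark after Thm. 7)] -/
theorem unipotentConjChar_eq_colRangeDiagModulus
    [MeasurableSpace (GL (Fin n) (AdeleRing (𝓞 K) K))] [BorelSpace (GL (Fin n) (AdeleRing (𝓞 K) K))]
    (d : Fin n → (AdeleRing (𝓞 K) K)ˣ) :
    unipotentConjChar d = colRangeDiagModulus (n := n) (K := K) 1 (n - 1) d := by
  letI : MeasurableSpace ↥(adelicUnipotent n K) := unipotentBorel n K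
  haveI : BorelSpace ↥(adelicUnipotent n K) := borelSpace_unipotent n K
  haveI : T2Space (GL (Fin n) (AdeleRing (𝓞 K) K)) := t2Space_gl n K
  haveI : LocallyCompactSpace (GL (Fin n) (AdeleRing (𝓞 K) K)) :=
    AdelicGroupData.locallyCompactSpace_generalLinearGroup_adeleRing K (Fin n)
  haveI : SecondCountableTopology (GL (Fin n) (AdeleRing (𝓞 K) K)) :=
    secondCountableTopology_generalLinearGroup_adeleRing K (Fin n)
  have hUcl : IsClosed ((adelicUnipotent n K : Subgroup (GL (Fin n) (AdeleRing (𝓞 K) K))) :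
      Set (GL (Fin n) (AdeleRing (𝓞 K) K))) := isClosed_adelicUnipotent n K
  have hCcl : IsClosed ((adelicColRange n K 1 (n - 1) : Subgroup (GL (Fin n) (AdeleRing (𝓞 K) K))) :
      Set (GL (Fin n) (AdeleRing (𝓞 K) K))) := by
    rw [adelicColRange_one_eq_adelicUnipotent]; exact isClosed_adelicUnipotent n K
  haveI : LocallyCompactSpace ↥(adelicUnipotent n K) := hUcl.locallyCompactSpace
  haveI : LocallyCompactSpace ↥(adelicColRange n K 1 (n - 1)) := hCcl.locallyCompactSpace
  haveI : SecondCountableTopology ↥(adelicUnipotent n K) :=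
    TopologicalSpace.Subtype.secondCountableTopology _
  haveI : SecondCountableTopology ↥(adelicColRange n K 1 (n - 1)) :=
    TopologicalSpace.Subtype.secondCountableTopology _
  -- the identity map `N_n(𝔸_K) → U_{[1,n-1]}(𝔸_K)` as a topological group isomorphism
  have hle₁ : adelicUnipotent n K ≤ adelicColRange n K 1 (n - 1) :=
    (adelicColRange_one_eq_adelicUnipotent n K).ge
  have hle₂ : adelicColRange n K 1 (n - 1) ≤ adelicUnipotent n K :=
    (adelicColRange_one_eq_adelicUnipotent n K).le
  let e : ↥(adelicUnipotent n K) ≃ₜ* ↥(adelicColRange n K 1 (n - 1)) :=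
    { toFun := fun u => ⟨u.1, hle₁ u.2⟩
      invFun := fun u => ⟨u.1, hle₂ u.2⟩
      left_inv := fun _ => rfl
      right_inv := fun _ => rfl
      map_mul' := fun _ _ => rfl
      continuous_toFun := continuous_subtype_val.subtype_mk _
      continuous_invFun := continuous_subtype_val.subtype_mk _ }
  exact mulEquivHaarChar_eq_of_semiconj e (unipotentDiagConj d)
    (colRangeDiagConj (n := n) (K := K) 1 (n - 1) d) fun u => rfl

/-- **Explicit modulus**: `χ(diag(d)) = ∏_{i<j} ‖dᵢ/dⱼ‖_𝔸` on `N_n(𝔸_K)` (Godement, Sém. Bourbaki 257,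
§8; Getz–Hahn (2024), (3.10): the modulus of `Ad(t)` on the unipotent radical is the product of the
positive roots). [cite: Godement1964, §8 (remark after Thm. 7)] -/
theorem unipotentConjChar_eq_prod [LocallyCompactSpace (AdeleRing (𝓞 K) K)]
    (d : Fin n → (AdeleRing (𝓞 K) K)ˣ) :
    (unipotentConjChar d : ℝ≥0∞) =
      ∏ i : Fin n, ∏ j : Fin n,
        (if i < j then (distribHaarChar (AdeleRing (𝓞 K) K) (d i * (d j)⁻¹) : ℝ≥0∞) else 1) := by
  rcases Nat.eq_zero_or_pos n with hn | hn
  · subst hn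
    simp only [Finset.univ_eq_empty, Finset.prod_empty]
    -- `N_0` is trivial, hence compact
    letI : MeasurableSpace ↥(adelicUnipotent 0 K) := unipotentBorel 0 K
    haveI : BorelSpace ↥(adelicUnipotent 0 K) := borelSpace_unipotent 0 K
    haveI : Subsingleton ↥(adelicUnipotent 0 K) := ⟨fun u v => Subtype.ext (Subsingleton.elim _ _)⟩
    haveI : CompactSpace ↥(adelicUnipotent 0 K) := Finite.compactSpace
    rw [unipotentConjChar_apply, mulEquivHaarChar_eq_one_of_compactSpace]; simp
  letI : MeasurableSpace (GL (Fin n) (AdeleRing (𝓞 K) K)) := glAdeleBorel n K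
  haveI : BorelSpace (GL (Fin n) (AdeleRing (𝓞 K) K)) := borelSpace_glAdele n K
  rw [unipotentConjChar_eq_colRangeDiagModulus, colRangeDiagModulus_one_eq_prod d (n - 1) (by omega)]
  -- reindex `∏_{c ∈ [1, n-1]} ∏_{i < c} = ∏_j ∏_{i<j}` and swap
  have hcol : ∀ j : Fin n, colDiagFactor (K := K) d (j : ℕ) =
      ∏ i : Fin n, (if i < j then (distribHaarChar (AdeleRing (𝓞 K) K) (d i * (d j)⁻¹) : ℝ≥0∞) else 1) := by
    intro j
    unfold colDiagFactor
    rw [dif_pos j.2, ← Finset.prod_filter]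
    have hj : (⟨(j : ℕ), j.2⟩ : Fin n) = j := Fin.ext rfl
    rw [hj]
    refine (Finset.prod_subtype (Finset.univ.filter fun i : Fin n => i < j) (fun i => ?_)
      (fun i : Fin n => (distribHaarChar (AdeleRing (𝓞 K) K) (d i * (d j)⁻¹) : ℝ≥0∞))).symm
    simp only [Finset.mem_filter, Finset.mem_univ, true_and, Fin.lt_def]
  have hrange : ∏ c ∈ Finset.Icc 1 (n - 1), colDiagFactor (K := K) d c =
      ∏ c ∈ Finset.range n, colDiagFactor (K := K) d c := by
    have h0 : colDiagFactor (K := K) d 0 = 1 := by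
      unfold colDiagFactor
      rw [dif_pos hn]
      exact Finset.prod_eq_one fun i _ => absurd i.2 (Nat.not_lt_zero _)
    have hsplit : Finset.range n = insert 0 (Finset.Icc 1 (n - 1)) := by
      ext c; simp only [Finset.mem_range, Finset.mem_insert, Finset.mem_Icc]; omega
    rw [hsplit, Finset.prod_insert (by simp), h0, one_mul]
  rw [hrange, ← Fin.prod_univ_eq_prod_range (fun c => colDiagFactor (K := K) d c) n]
  simp_rw [hcol]
  exact Finset.prod_comm

/-- **The modulus at a positive real diagonal matrix** `t = diag(z(a₁), …, z(aₙ))` (`z = posRealIdele K`,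
the real scalar `aᵢ > 0` at every archimedean place, `1` at the finite places):
`χ(t) = (∏_{i<j} aᵢ/aⱼ)^{[K:ℚ]}` (Godement, Sém. Bourbaki 257, §8; Getz–Hahn (2024), (3.10), with
`‖z(r)‖_𝔸 = r^{[K:ℚ]}`, Weil BNT IV §4). This is `δ_B(t)`, the modular function of the upper triangular
Borel subgroup of `GL_n(𝔸_K)` at `t`. [cite: Godement1964, §8 (remark after Thm. 7)] -/
theorem unipotentConjChar_posRealIdele_eq [LocallyCompactSpace (AdeleRing (𝓞 K) K)] (a : Fin n → ℝ≥0ˣ) :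
    ((unipotentConjChar (fun i => posRealIdele K (a i)) : ℝ≥0) : ℝ) =
      (∏ i : Fin n, ∏ j : Fin n,
        (if i < j then ((a i : ℝ≥0) : ℝ) / ((a j : ℝ≥0) : ℝ) else 1)) ^ Module.finrank ℚ K := by
  have h := unipotentConjChar_eq_prod n K (fun i => posRealIdele K (a i))
  have hfac : ∀ i j : Fin n, distribHaarChar (AdeleRing (𝓞 K) K)
      (posRealIdele K (a i) * (posRealIdele K (a j))⁻¹) = ((a i * (a j)⁻¹ : ℝ≥0ˣ) : ℝ≥0) ^ Module.finrank ℚ K := by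
    intro i j
    rw [← map_inv, ← map_mul, AdeleRing.distribHaarChar_posRealIdele]
  simp_rw [hfac] at h
  -- pass from `ℝ≥0∞` to `ℝ≥0` to `ℝ`
  set P : ℝ≥0 := ∏ i : Fin n, ∏ j : Fin n,
    (if i < j then ((a i * (a j)⁻¹ : ℝ≥0ˣ) : ℝ≥0) ^ Module.finrank ℚ K else 1) with hP
  have h' : unipotentConjChar (fun i => posRealIdele K (a i)) = P := by
    have : (unipotentConjChar (fun i => posRealIdele K (a i)) : ℝ≥0∞) = (P : ℝ≥0∞) := by
      rw [h, hP]; push_cast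
      refine Finset.prod_congr rfl fun i _ => Finset.prod_congr rfl fun j _ => ?_
      split_ifs <;> simp
    exact_mod_cast this
  rw [h', hP]
  push_cast
  rw [← Finset.prod_pow]
  refine Finset.prod_congr rfl fun i _ => ?_
  rw [← Finset.prod_pow]
  refine Finset.prod_congr rfl fun j _ => ?_
  by_cases hij : i < j
  · simp [hij, div_eq_mul_inv]
  · simp [hij]

end Bridge

end Literature.NumberTheory.Automorphic
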